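import Literature.NumberTheory.GaloisRepresentations.LocalGlobalCohomologyDualityProofs
import HarnessLib

/-!
# X11b, route R1 — annihilators under a perfect `ℤ/n`-valued pairing of finite groups
# (the counting behind "exact orthogonal complements")

HONEST FRAMING (cell `b2b-bsdres`, run/shared/lean/b2b/bsd-rank1-residual/, verbatim in every
file): the goal of the cell is to DELETE the COMBINATION-SHAPED residual classes of the
Birch–Swinnerton-Dyer formula for ALL analytic-rank `≤ 1` elliptic curves over `ℚ` — "full BSD
formula for every rank `≤ 1` curve in class `C`" assembled STRICTLY from published theorems — so
that the rank-`≤ 1` remainder becomes exactly the CONSTRUCTION-SHAPED classes, which are TYPED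
(missing-input `Prop`s), NOT attempted. This is not "finishing BSD". Sub-cell
`b2b-bsdres-multr1-p1` (X11b, route R1 = Castella 2018 Thm. A re-proved along the author's
erratum); a RESEARCH ROUTE; no claim beyond the stated class; X11b stays CONSTRUCTION-SHAPED;
nothing here changes a label; no named fact is minted (two definitions with bodies and theorems of
finite group theory; no `sorry`).

## Why this file

Route R1's control input (CTL) = Cas18 Thm. 2.3 is, in the kernel, four verbatim atoms of
Jetchev–Skinner–Wan 2017 §3 (`AnticyclotomicControlAtoms.lean`), three of which — (P6) the count
of Castella's Selmer group over `K` (JSW Prop. 3.2.1), (P9) surjectivity of localisation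
(Prop. 3.3.2), (L10) trivial coinvariants (Lemma 3.3.3) — are consequences of Poitou–Tate global
duality for Selmer structures, "the images of the two localisation maps are exact orthogonal
complements" (Howard 2004 Thm. 2.1.11 = Mazur–Rubin Thm. 2.3.4, typed at finite level as the named
fact `Literature.NumberTheory.GaloisCohomology.poitouTate_selmerStructure_duality`).  The proofs
of Prop. 3.2.1 USE that statement in COUNTING form ("`#im(α) = #coker(β)`, where the second
equality follows from Theorem 2.3.4", arXiv:1512.06894 p. 10).  Turning "`X` and `Y` are exact
annihilators of each other under a perfect pairing" into "`#X · #Y = #A`" is finite group theory;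
this file supplies it once, for any bi-additive `b : A × B → ℤ/n` of finite abelian groups killed
by `n` both of whose adjoints are bijective (the tree's rendering of "perfect", as in
`LocalInvariants.IsPerfect` and `exists_perfectPairing_galoisCohomology_tateDual`):

* `annRight b A'` / `annLeft b B'` — the annihilator of `A' ≤ A` in `B` / of `B' ≤ B` in `A`;
* `restrictHom_surjective` — `Hom(A, ℤ/n) → Hom(A', ℤ/n)` is onto (`ℤ/n`-valued characters of a
  subgroup extend; by counting, `#Hom(C, ℤ/n) = #C`);
* **`natCard_annRight_mul`: `#A'^⊥ · #A' = #B`**, **`natCard_annLeft_mul`: `#{}^⊥B' · #B' = #A`**,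
  `natCard_eq_of_bijective`: `#A = #B`;
* **`annLeft_annRight`: `{}^⊥(A'^⊥) = A'`** and `annRight_annLeft` (double annihilator);
* **`natCard_mul_natCard_eq_of_eq_annLeft`**: if `X = {}^⊥Y` then `#X · #Y = #A` — the counting
  form of "exact orthogonal complements"; **`relIndex_annRight_eq`: `[G : F] = [F^⊥ : G^⊥]`**.

References: Milne, *Arithmetic Duality Theorems* (2006), I §0 (pairings, Prop. 0.19);
Washington, *Galois cohomology* (CSS 1997), §1, §5; the tree's
`Literature.NumberTheory.GaloisRepresentations.Nat.card_addMonoidHom_zmod` /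
`exists_addMonoidHom_zmod_apply_ne_zero` (`LocalGlobalCohomologyDualityProofs.lean`).
-/

noncomputable section

open Function

namespace Summit.BirchSwinnertonDyer.Rank1Residual.X11b.FiniteDuality

open Literature.NumberTheory.GaloisRepresentations

variable {A : Type*} [AddCommGroup A] {B : Type*} [AddCommGroup B] {n : ℕ}

/-! ## Annihilators -/

/-- The **right annihilator** `A'^⊥ = {y ∈ B | b(x, y) = 0 ∀ x ∈ A'}` of a subgroup `A' ≤ A` under
a bi-additive pairing `b : A × B → ℤ/n`. [folklore] -/
def annRight (b : A →+ B →+ ZMod n) (A' : AddSubgroup A) : AddSubgroup B where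
  carrier := {y | ∀ x ∈ A', b x y = 0}
  zero_mem' := fun x _ => by simp only [map_zero]
  add_mem' := fun {y y'} hy hy' x hx => by simp only [map_add, hy x hx, hy' x hx, add_zero]
  neg_mem' := fun {y} hy x hx => by simp only [map_neg, hy x hx, neg_zero]

/-- The **left annihilator** `{}^⊥B' = {x ∈ A | b(x, y) = 0 ∀ y ∈ B'}` of a subgroup `B' ≤ B`.
[folklore] -/
def annLeft (b : A →+ B →+ ZMod n) (B' : AddSubgroup B) : AddSubgroup A where
  carrier := {x | ∀ y ∈ B', b x y = 0}
  zero_mem' := fun y _ => by simp only [map_zero, AddMonoidHom.zero_apply]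
  add_mem' := fun {x x'} hx hx' y hy => by
    simp only [map_add, AddMonoidHom.add_apply, hx y hy, hx' y hy, add_zero]
  neg_mem' := fun {x} hx y hy => by simp only [map_neg, AddMonoidHom.neg_apply, hx y hy, neg_zero]

/-- Membership in the right annihilator. [folklore] -/
@[simp] theorem mem_annRight_iff (b : A →+ B →+ ZMod n) (A' : AddSubgroup A) (y : B) :
    y ∈ annRight b A' ↔ ∀ x ∈ A', b x y = 0 := Iff.rfl

/-- Membership in the left annihilator. [folklore] -/
@[simp] theorem mem_annLeft_iff (b : A →+ B →+ ZMod n) (B' : AddSubgroup B) (x : A) :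
    x ∈ annLeft b B' ↔ ∀ y ∈ B', b x y = 0 := Iff.rfl

/-- The left annihilator for `b` is the right annihilator for `b.flip`. [folklore] -/
theorem annLeft_eq_annRight_flip (b : A →+ B →+ ZMod n) (B' : AddSubgroup B) :
    annLeft b B' = annRight b.flip B' := by
  ext x; simp only [mem_annLeft_iff, mem_annRight_iff, AddMonoidHom.flip_apply]

/-- The right annihilator for `b` is the left annihilator for `b.flip`. [folklore] -/
theorem annRight_eq_annLeft_flip (b : A →+ B →+ ZMod n) (A' : AddSubgroup A) :
    annRight b A' = annLeft b.flip A' := by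
  ext y; simp only [mem_annLeft_iff, mem_annRight_iff, AddMonoidHom.flip_apply]

/-- Annihilators reverse inclusions. [folklore] -/
theorem annRight_anti (b : A →+ B →+ ZMod n) {A' A'' : AddSubgroup A} (h : A' ≤ A'') :
    annRight b A'' ≤ annRight b A' := fun _ hy x hx => hy x (h hx)

/-- Annihilators reverse inclusions. [folklore] -/
theorem annLeft_anti (b : A →+ B →+ ZMod n) {B' B'' : AddSubgroup B} (h : B' ≤ B'') :
    annLeft b B'' ≤ annLeft b B' := fun _ hx y hy => hx y (h hy)

/-- `A' ≤ {}^⊥(A'^⊥)`. [folklore] -/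
theorem le_annLeft_annRight (b : A →+ B →+ ZMod n) (A' : AddSubgroup A) :
    A' ≤ annLeft b (annRight b A') := fun _ hx _ hy => hy _ hx

/-- `B' ≤ ({}^⊥B')^⊥`. [folklore] -/
theorem le_annRight_annLeft (b : A →+ B →+ ZMod n) (B' : AddSubgroup B) :
    B' ≤ annRight b (annLeft b B') := fun _ hy _ hx => hx _ hy

/-- The annihilator of a join is the meet of the annihilators. [folklore] -/
theorem annLeft_sup (b : A →+ B →+ ZMod n) (B' B'' : AddSubgroup B) :
    annLeft b (B' ⊔ B'') = annLeft b B' ⊓ annLeft b B'' := by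
  refine le_antisymm (le_inf (annLeft_anti b le_sup_left) (annLeft_anti b le_sup_right)) ?_
  rintro x ⟨h', h''⟩ y hy
  obtain ⟨y', hy', y'', hy'', rfl⟩ := AddSubgroup.mem_sup.mp hy
  rw [map_add, h' y' hy', h'' y'' hy'', add_zero]

/-- The annihilator of a join is the meet of the annihilators. [folklore] -/
theorem annRight_sup (b : A →+ B →+ ZMod n) (A' A'' : AddSubgroup A) :
    annRight b (A' ⊔ A'') = annRight b A' ⊓ annRight b A'' := by
  rw [annRight_eq_annLeft_flip, annRight_eq_annLeft_flip, annRight_eq_annLeft_flip, annLeft_sup]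

/-! ## Extension of `ℤ/n`-valued characters from a subgroup (by counting) -/

/-- Restriction of `ℤ/n`-valued characters to a subgroup, as an additive map
`Hom(A, ℤ/n) →+ Hom(A', ℤ/n)`. [folklore] -/
def restrictHom (A' : AddSubgroup A) (n : ℕ) : (A →+ ZMod n) →+ (A' →+ ZMod n) where
  toFun f := f.comp A'.subtype
  map_zero' := rfl
  map_add' _ _ := rfl

/-- Unfolding `restrictHom`. [folklore] -/
@[simp] theorem restrictHom_apply (A' : AddSubgroup A) (n : ℕ) (f : A →+ ZMod n) (x : A') :
    restrictHom A' n f x = f x := rfl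

/-- The kernel of restriction to `A'` is in bijection with `Hom(A/A', ℤ/n)`. [folklore] -/
theorem natCard_ker_restrictHom (A' : AddSubgroup A) (n : ℕ) :
    Nat.card (restrictHom A' n).ker = Nat.card (A ⧸ A' →+ ZMod n) := by
  refine Nat.card_congr
    { toFun := fun f => QuotientAddGroup.lift A' f.1 fun x hx => ?_
      invFun := fun g => ⟨g.comp (QuotientAddGroup.mk' A'), ?_⟩
      left_inv := fun f => Subtype.ext (AddMonoidHom.ext fun x => by simp)
      right_inv := fun g => AddMonoidHom.ext fun x => by
        induction x using QuotientAddGroup.induction_on with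
        | H a => simp }
  · have hf := f.2
    rw [AddMonoidHom.mem_ker] at hf
    have := DFunLike.congr_fun hf ⟨x, hx⟩
    simpa using this
  · rw [AddMonoidHom.mem_ker]
    ext x
    simp only [restrictHom_apply, AddMonoidHom.coe_comp, QuotientAddGroup.coe_mk', comp_apply,
      AddMonoidHom.zero_apply, (QuotientAddGroup.eq_zero_iff (x : A)).mpr x.2, map_zero]

/-- **`ℤ/n`-valued characters of a subgroup extend**: for a finite abelian group `A` killed by
`n ≠ 0` and `A' ≤ A`, restriction `Hom(A, ℤ/n) → Hom(A', ℤ/n)` is surjective.  Proof by counting: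
`#Hom(A, ℤ/n) = #A`, the kernel is `Hom(A/A', ℤ/n)` of order `#(A/A')`, so the image has order
`#A / #(A/A') = #A' = #Hom(A', ℤ/n)`.  (Milne, *ADT* I Prop. 0.19: `M ↦ M^*` is exact on finite
groups.) [folklore] -/
theorem restrictHom_surjective [Finite A] [NeZero n] (hA : ∀ a : A, n • a = 0)
    (A' : AddSubgroup A) : Surjective (restrictHom A' n) := by
  haveI := finite_addMonoidHom_zmod A n
  haveI := finite_addMonoidHom_zmod A' n
  have hA' : ∀ a : A', n • a = 0 := fun a => Subtype.ext (by simpa using hA a)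
  have hQ : ∀ q : A ⧸ A', n • q = 0 := fun q => by
    induction q using QuotientAddGroup.induction_on with
    | H a => rw [← QuotientAddGroup.mk_nsmul, hA a, QuotientAddGroup.mk_zero]
  -- `#Hom(A) = #ker · #range`, `#ker = #(A/A')`, `#Hom(A) = #A = #(A/A') · #A'`
  have h1 : Nat.card (restrictHom A' n).ker * Nat.card (restrictHom A' n).range =
      Nat.card (A →+ ZMod n) := by
    rw [← AddSubgroup.index_ker, AddSubgroup.card_mul_index]
  rw [natCard_ker_restrictHom, Nat.card_addMonoidHom_zmod hQ, Nat.card_addMonoidHom_zmod hA,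
    ← AddSubgroup.index_eq_card, ← AddSubgroup.card_mul_index A', mul_comm] at h1
  have hidx : A'.index ≠ 0 := AddSubgroup.index_ne_zero_of_finite
  have hrange : Nat.card (restrictHom A' n).range = Nat.card (A' →+ ZMod n) := by
    rw [Nat.card_addMonoidHom_zmod hA']
    exact mul_right_cancel₀ hidx h1
  exact AddMonoidHom.range_eq_top.mp (AddSubgroup.eq_top_of_card_eq _ hrange)

/-! ## Perfect pairings: annihilator cardinalities, double annihilators, indices -/

section Perfect

/-- **`#A = #B`** when the adjoint `A → Hom(B, ℤ/n)` is bijective and `n · B = 0`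
(`#Hom(B, ℤ/n) = #B`). [folklore] -/
theorem natCard_eq_of_bijective [Finite B] [NeZero n] (hB : ∀ y : B, n • y = 0) (b : A →+ B →+ ZMod n)
    (hb : Bijective b) : Nat.card A = Nat.card B := by
  haveI := finite_addMonoidHom_zmod B n
  rw [Nat.card_congr (Equiv.ofBijective b hb), Nat.card_addMonoidHom_zmod hB]

/-- **`#A'^⊥ · #A' = #B`**: for `n · A = 0` and the adjoint `B → Hom(A, ℤ/n)` bijective, the right
annihilator of `A' ≤ A` has index `#A'` in `B` — it is the kernel of the surjection
`B ≅ Hom(A, ℤ/n) ↠ Hom(A', ℤ/n)` (`restrictHom_surjective`).  Milne, *ADT* I §0 (exactness of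
`M ↦ M^*` on finite groups). [folklore] -/
theorem natCard_annRight_mul [Finite A] [NeZero n] (hA : ∀ x : A, n • x = 0) (b : A →+ B →+ ZMod n)
    (hflip : Bijective b.flip) (A' : AddSubgroup A) :
    Nat.card (annRight b A') * Nat.card A' = Nat.card B := by
  set φ : B →+ (A' →+ ZMod n) := (restrictHom A' n).comp b.flip with hφ
  have hsurj : Surjective φ := (restrictHom_surjective hA A').comp hflip.2
  have hker : φ.ker = annRight b A' := by
    ext y
    simp only [AddMonoidHom.mem_ker, mem_annRight_iff, hφ]
    constructor
    · intro h x hx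
      have := DFunLike.congr_fun h ⟨x, hx⟩
      simpa using this
    · intro h
      ext x
      simpa using h x x.2
  have hA' : ∀ a : A', n • a = 0 := fun a => Subtype.ext (by simpa using hA a)
  haveI := finite_addMonoidHom_zmod A' n
  have h := AddSubgroup.card_mul_index φ.ker
  rw [AddSubgroup.index_ker, AddMonoidHom.range_eq_top.mpr hsurj, AddSubgroup.card_top,
    Nat.card_addMonoidHom_zmod hA', hker] at h
  exact h

/-- `b.flip.flip = b`. [folklore] -/
theorem flip_flip (b : A →+ B →+ ZMod n) : b.flip.flip = b := by
  ext; rfl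

/-- **`#{}^⊥B' · #B' = #A`** (the left-handed version of `natCard_annRight_mul`: `n · B = 0` and the
adjoint `A → Hom(B, ℤ/n)` bijective). [folklore] -/
theorem natCard_annLeft_mul [Finite B] [NeZero n] (hB : ∀ y : B, n • y = 0) (b : A →+ B →+ ZMod n)
    (hb : Bijective b) (B' : AddSubgroup B) :
    Nat.card (annLeft b B') * Nat.card B' = Nat.card A := by
  rw [annLeft_eq_annRight_flip]
  exact natCard_annRight_mul hB b.flip (by rw [flip_flip]; exact hb) B'

/-- **Double annihilator `{}^⊥(A'^⊥) = A'`** for a perfect pairing (both adjoints bijective) of finite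
groups killed by `n`: `A' ≤ {}^⊥(A'^⊥)` always, and both have order `#A / #A'^⊥`
(`#A = #B`).  Milne, *ADT* I Prop. 0.19 (`M** = M` for finite `M`). [folklore] -/
theorem annLeft_annRight [Finite A] [Finite B] [NeZero n] (hA : ∀ x : A, n • x = 0) (hB : ∀ y : B, n • y = 0)
    (b : A →+ B →+ ZMod n) (hb : Bijective b) (hflip : Bijective b.flip) (A' : AddSubgroup A) :
    annLeft b (annRight b A') = A' := by
  symm
  refine AddSubgroup.eq_of_le_of_card_ge (le_annLeft_annRight b A') (le_of_eq ?_)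
  have h1 := natCard_annLeft_mul hB b hb (annRight b A')
  have h2 := natCard_annRight_mul hA b hflip A'
  have h3 := natCard_eq_of_bijective hB b hb
  have hpos : 0 < Nat.card (annRight b A') := Nat.card_pos
  refine Nat.eq_of_mul_eq_mul_right hpos ?_
  rw [h1, h3, ← h2, mul_comm]

/-- **Double annihilator `({}^⊥B')^⊥ = B'`** (right-handed version). [folklore] -/
theorem annRight_annLeft [Finite A] [Finite B] [NeZero n] (hA : ∀ x : A, n • x = 0) (hB : ∀ y : B, n • y = 0)
    (b : A →+ B →+ ZMod n) (hb : Bijective b) (hflip : Bijective b.flip) (B' : AddSubgroup B) :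
    annRight b (annLeft b B') = B' := by
  rw [annRight_eq_annLeft_flip, annLeft_eq_annRight_flip]
  exact annLeft_annRight hB hA b.flip hflip (by rw [flip_flip]; exact hb) B'

/-- **Counting form of "exact orthogonal complements"**: if `X ≤ A` is the left annihilator of
`Y ≤ B` under a pairing whose adjoint `A → Hom(B, ℤ/n)` is bijective (`n · B = 0`), then
`#X · #Y = #A`.  This is how "the images are exact orthogonal complements" (Howard 2004
Thm. 2.1.11) is consumed as "`#im(α) = #coker(β)`" (Jetchev–Skinner–Wan 2017, proof of Prop. 3.2.1).
[folklore] -/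
theorem natCard_mul_natCard_eq_of_eq_annLeft [Finite B] [NeZero n] (hB : ∀ y : B, n • y = 0) (b : A →+ B →+ ZMod n)
    (hb : Bijective b) {X : AddSubgroup A} {Y : AddSubgroup B} (h : X = annLeft b Y) :
    Nat.card X * Nat.card Y = Nat.card A := by
  subst h
  exact natCard_annLeft_mul hB b hb Y

/-- `#H · [K : H] = #K` for `H ≤ K` (relative index inside a finite group). [folklore] -/
theorem natCard_mul_relIndex_of_le {G : Type*} [AddCommGroup G] [Finite G] {H K : AddSubgroup G}
    (h : H ≤ K) : Nat.card H * H.relIndex K = Nat.card K := by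
  have hK : K.index ≠ 0 := AddSubgroup.index_ne_zero_of_finite
  refine mul_right_cancel₀ hK ?_
  rw [mul_assoc, AddSubgroup.relIndex_mul_index h, AddSubgroup.card_mul_index,
    AddSubgroup.card_mul_index]

/-- **Duality exchanges indices: `[G_v : F_v] = [F_v^⊥ : G_v^⊥]`** for local conditions
`F_v ≤ G_v ≤ A` under a perfect pairing (the statement that the induced pairing
`G_v/F_v × F_v^⊥/G_v^⊥ → ℤ/n` is a perfect pairing of groups of the same order; Howard 2004 §2.1,
the quotients in Thm. 2.1.11). [folklore] -/
theorem relIndex_annRight_eq [Finite A] [Finite B] [NeZero n] (hA : ∀ x : A, n • x = 0) (b : A →+ B →+ ZMod n)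
    (hflip : Bijective b.flip) {F G : AddSubgroup A} (hFG : F ≤ G) :
    (annRight b G).relIndex (annRight b F) = F.relIndex G := by
  have hF := natCard_annRight_mul hA b hflip F
  have hG := natCard_annRight_mul hA b hflip G
  have h1 := natCard_mul_relIndex_of_le hFG
  have h2 := natCard_mul_relIndex_of_le (annRight_anti b hFG)
  -- `#G^⊥ · [F^⊥ : G^⊥] · #F... ` : multiply out and cancel
  have hposF : 0 < Nat.card F := Nat.card_pos
  have hposG' : 0 < Nat.card (annRight b G) := Nat.card_pos
  -- #G^⊥ * r₂ = #F^⊥ and #F * r₁ = #G; also #F^⊥ * #F = #B = #G^⊥ * #G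
  -- ⟹ #G^⊥ * r₂ * #F = #B = #G^⊥ * #F * r₁ ⟹ r₂ = r₁
  have key : Nat.card (annRight b G) * Nat.card F * (annRight b G).relIndex (annRight b F) =
      Nat.card (annRight b G) * Nat.card F * F.relIndex G := by
    calc Nat.card (annRight b G) * Nat.card F * (annRight b G).relIndex (annRight b F)
        = Nat.card (annRight b G) * (annRight b G).relIndex (annRight b F) * Nat.card F := by ring
      _ = Nat.card (annRight b F) * Nat.card F := by rw [h2]
      _ = Nat.card B := hF
      _ = Nat.card (annRight b G) * Nat.card G := hG.symm
      _ = Nat.card (annRight b G) * (Nat.card F * F.relIndex G) := by rw [h1]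
      _ = Nat.card (annRight b G) * Nat.card F * F.relIndex G := by ring
  exact Nat.eq_of_mul_eq_mul_left (Nat.mul_pos hposG' hposF) key

end Perfect

end Summit.BirchSwinnertonDyer.Rank1Residual.X11b.FiniteDuality

end
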